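import Summits.QuantumFields.YangMills.Theorems.BalabanUVNodesN15KingModelB9Thm31HolderAtTrivialU
import Summits.QuantumFields.YangMills.Theorems.BalabanUVNodesN15KingModelFullPropagatorLaplacian

/-!
# BalabanUVNodes ∕ N15 — THE KING-MODEL RUNG, CURVED EDITION (PACKAGE, COMPLETE): [B9] THEOREM 3.1 AT `U ≡ 1` FOR KING'S FULL `A = 0` PROPAGATOR —
# THE FOUR SUP ENTRIES (3.42) `|Gλ|, |∇Gλ|, |G∇*λ|, |ΔGλ|`, THE TWO HÖLDER NORMS (3.43), THE MIXED SUP (3.44) AND ITS HÖLDER NORM (3.45), AT ONE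
# SPACING, UNDER ONE `(C, δ)`, UNIFORMLY in `K`, the volume and the mass (the `L²` block (3.46)–(3.47) is part X `fullPropOps_l2_unif`)
# (Track A, DAG node N15 = NE2; FAN-OUT v1.1 §N15 s3 «KING-MODEL RUNG … + the one-line statement of what the curved case adds»)

HONEST FRAMING.  Count-neutral PACKAGING (cell `pub-ymgap`, seat `pub-ymgap-dag-n15-e` g10; `--supports stmt-QuantumFields-20544 --as helper` = K3⁷
`SpineGivenEndpointR13SepCoPH`, WORDS-143).  TEMPLATE LITERATURE, `A = 0`: C. King's scalar U(1)-Higgs MODEL on finite tori ([King1986] (2.13) p. 653,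
(4.1)–(4.5) p. 670, Thm 3.3 (3.7)–(3.8) pp. 655–656, Prop. 3.7 (3.63)∕(3.65) p. 663), NOT Bałaban's covariant objects.  [Balaban1985BackgroundPropagators]
Thm 3.1 pp. 397–398 prints, for `G′(U)` over the live window `Reg335` on the multiscale carrier, the sup entries (3.42) «`|(G′λ)(x)|, |(∇_UG′λ)(x)|,
|(G′∇*_Uλ)(x)|, |(Δ_UG′λ)(x)| ≤ B₀[(L^jη)², L^jη, L^jη, 1]e^{−δ₀d(y,y′)}|λ|`», the Hölder norms (3.43), the mixed sup (3.44) (with `‖λ‖_ε`), its Hölder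
norm (3.45), the `L²` bounds (3.46) and the global bounds (3.47).  For King's FULL `A = 0` propagator `A₀⁻¹ = G_K(T_ε, 0)` at `U ≡ 1` (unit-scale sites
`L^kη = 1`, η-lattice test functions) the tree decides every one of these displays; THIS FILE reads the four (3.42) sups at ONE spacing in the cube
format of the rung (§1: [Ba 4] (1.10) in King's spelling = O1 v1.2 `fineOp_inv_mulVec_decay_unif`, its clause 2 = Q1 `fineOp_inv_deriv_mulVec_decay_unif`,
the transposed gradient = Q3a `fullPropDTOp_decay_unif` through Q4a `inv_mulVec_adjDeriv_eq_sum`, the Laplacian entry through the equation Q4b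
`lap_inv_mulVec_eq`) and packages them with the Hölder ∕ mixed block of part Ψ-d under ONE `(C, δ)` (§2) — the single citable name for «Theorem 3.1 at
`U ≡ 1` in King's model».  NOT the printed proposition (covariant `G(U)`, `Reg335`, multiscale sites, cut-offs `ζ`); NE2⁺ is NOT PRINTED and not proved;
NOT a node discharge; count-neutral; nothing continuum ∕ ℝ⁴ ∕ OS ∕ mass-gap ∕ Clay.  0 `sorry`, 0 `def`, standard axioms.
* §1 `fullPropOp_sup_decay` (`|(A₀⁻¹λ)(x)| ≤ Ce^{−δD}‖λ‖_∞`), `fullPropDOp_sup_decay` (`|N((A₀⁻¹λ)(x+e_μ) − (A₀⁻¹λ)(x))|`), `fullPropAdjOp_sup_decay`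
  (`|(A₀⁻¹∇*_νλ)(x)|`), `fullPropLapOp_sup_decay` (`|N²Σ_μ[(A₀⁻¹λ)(x+e_μ) + (A₀⁻¹λ)(x−e_μ) − 2(A₀⁻¹λ)(x)]|` — via `Δ^ηA₀⁻¹λ = m²A₀⁻¹λ + a_KQ*QA₀⁻¹λ − λ`);
* §2 ★★★ **`kingFullProp_B9Thm31_at_trivialU`** — (3.42)₀₋₃ ∧ (3.43)₁ ∧ (3.43)₂ ∧ (3.44) ∧ (3.45), one `(C, δ)`, `D ≥ 0` the block distance to `supp λ`.
WHAT THE CURVED CASE ADDS (one line): Theorem 3.1 itself — the same eight displays (and (3.46)–(3.47)) for `G′(U)`, `U` over `Reg335`, multiscale sites with the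
prefactors `[(L^jη)², L^jη, L^jη, 1]`, cut-offs, analyticity in `U` (Thm 3.4).
HONEST SCOPE.  (i) `A = 0`, periodic b.c., odd `L ≥ 3`, cubes `2L^e`, `K ≥ 1`, `0 < m² ≤ m₀²`, `d ≥ 1`; (ii) King's spelling `A₀ = fineOp N M a_K N² m²`
(`(A₀⁻¹f)(x) = η^{d+1}Σ_yG(x, y)f(y)`: unit-scale prefactors), forward η-differences, lattice units of level `K`, sup torus distance; (iii) GLOBAL sup norm ∕
Hölder modulus of the source, `ζ ≡ 1`; (iv) `0 < α < 1`, `0 < ε ≤ 1`; (v) not Bałaban's `G(U)`; not a discharge.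
Locators: [Balaban1985BackgroundPropagators] Thm 3.1 (3.39)–(3.41) p. 397, (3.42)–(3.47) pp. 397–398; [King1986] (2.13) p. 653, (4.1)–(4.5) p. 670, Thm 3.3
(3.7)–(3.8) pp. 655–656, Prop. 3.7 (3.63)∕(3.65) p. 663; [Balaban1983RegularityDecay] (1.6) p. 572, Theorem (1.9)–(1.10) p. 573.
-/

noncomputable section

namespace Summit.QuantumFields.YangMills.BalabanUVNodes.N15KingModelRung.Curved

open Real Finset Matrix
open Literature.MathematicalPhysics.QuantumFieldTheory.Balaban1983to89 (Params)
open Literature.MathematicalPhysics.QuantumFieldTheory.Balaban1983to89.B5Prop11Plancherel (Tor fine unitVec)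
open Literature.MathematicalPhysics.QuantumFieldTheory.King1986 (aK aK_pos aK_le)
open Literature.MathematicalPhysics.QuantumFieldTheory.King1986.Torus (fineOp constrainedProp blockProj blockOf tdistT tdistT_nonneg tdistT_symm
  tdistT_self fineOp_inv_mulVec_decay_unif fineOp_inv_deriv_mulVec_decay_unif)

variable {d : ℕ} (L : ℕ) [NeZero L]

/-! ## §1 The four (3.42) sup entries at one spacing, cube format -/

omit [NeZero L] in
/-- **(3.42), ENTRY `|Gλ|`, AT `U ≡ 1`**: `|(A₀⁻¹λ)(x)| ≤ C·e^{−δD}·‖λ‖_∞` for every `D ≤ dist(B(x), supp λ)` — [Ba 4] (1.10) in King's spelling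
(O1 v1.2 `fineOp_inv_mulVec_decay_unif`) read for the cubes `2L^e`, uniformly in `K`, the volume and the mass.
[cite: Balaban1985BackgroundPropagators, Thm 3.1 (3.42) p.397 (first entry); Balaban1983RegularityDecay, Theorem (1.10) p.573; King1986, Thm 3.3 (3.7) p.656] -/
theorem fullPropOp_sup_decay (hLodd : Odd L) (hL : 2 ≤ L) {a : ℝ} (ha : 0 < a) {m0sq : ℝ} (hm0 : 0 ≤ m0sq) :
    ∃ C δ : ℝ, 0 < C ∧ 0 < δ ∧ ∀ (K : ℕ), 1 ≤ K → ∀ (N : ℕ) [NeZero N], N = L ^ K →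
      ∀ (e : ℕ) (M : Fin (d + 1) → ℕ) [∀ μ, NeZero (M μ)], (∀ μ, M μ = 2 * L ^ e) →
      ∀ (msq : ℝ), 0 < msq → msq ≤ m0sq → ∀ (lam : Tor (fine N M) → ℝ) (F D : ℝ), (∀ y, |lam y| ≤ F) →
        ∀ x : Tor (fine N M), (∀ y, lam y ≠ 0 → D ≤ tdistT M (blockOf N M x) (blockOf N M y)) →
        |((fineOp N M (aK a L K) (((N : ℕ) : ℝ) ^ 2) msq)⁻¹ *ᵥ lam) x| ≤ C * Real.exp (-(δ * D)) * F := by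
  have hL1 : 1 < L := by omega
  obtain ⟨δ₀, c₀, hδ₀, hc₀, H₀⟩ := fineOp_inv_mulVec_decay_unif (d + 1) L (by omega) ⟨hLodd, hL1⟩ ha hm0
  refine ⟨c₀, δ₀, hc₀, hδ₀, ?_⟩
  intro K hK N _ hN e M _ hM msq hmsq hcap lam F D hF x hD
  set P : Params := ⟨d + 1, L, e, K, by omega, ⟨hLodd, hL1⟩⟩ with hP
  have hMK : ∀ μ, M μ = P.sitesPerDir P.K := fun μ => by rw [hM μ]; simp [hP, Params.sitesPerDir]
  exact H₀ P rfl rfl hK msq hmsq.le hcap M hMK N hN lam F D hF x hD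

omit [NeZero L] in
/-- **(3.42), ENTRY `|∇Gλ|`, AT `U ≡ 1`**: `|N((A₀⁻¹λ)(x + e_μ) − (A₀⁻¹λ)(x))| ≤ C·e^{−δD}·‖λ‖_∞` — [Ba 4] (1.10) clause 2 in King's spelling (Q1
`fineOp_inv_deriv_mulVec_decay_unif`) for the cubes `2L^e`.
[cite: Balaban1985BackgroundPropagators, Thm 3.1 (3.42) p.397 (second entry); Balaban1983RegularityDecay, Theorem (1.10) p.573; King1986, Thm 3.3 (3.7) p.656] -/
theorem fullPropDOp_sup_decay (hLodd : Odd L) (hL : 2 ≤ L) {a : ℝ} (ha : 0 < a) {m0sq : ℝ} (hm0 : 0 ≤ m0sq) :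
    ∃ C δ : ℝ, 0 < C ∧ 0 < δ ∧ ∀ (K : ℕ), 1 ≤ K → ∀ (N : ℕ) [NeZero N], N = L ^ K →
      ∀ (e : ℕ) (M : Fin (d + 1) → ℕ) [∀ μ, NeZero (M μ)], (∀ μ, M μ = 2 * L ^ e) →
      ∀ (msq : ℝ), 0 < msq → msq ≤ m0sq → ∀ (μ : Fin (d + 1)) (lam : Tor (fine N M) → ℝ) (F D : ℝ), (∀ y, |lam y| ≤ F) →
        ∀ x : Tor (fine N M), (∀ y, lam y ≠ 0 → D ≤ tdistT M (blockOf N M x) (blockOf N M y)) →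
        |(N : ℝ) * (((fineOp N M (aK a L K) (((N : ℕ) : ℝ) ^ 2) msq)⁻¹ *ᵥ lam) (x + unitVec (fine N M) μ)
            - ((fineOp N M (aK a L K) (((N : ℕ) : ℝ) ^ 2) msq)⁻¹ *ᵥ lam) x)| ≤ C * Real.exp (-(δ * D)) * F := by
  have hL1 : 1 < L := by omega
  obtain ⟨δ₀, c₀, hδ₀, hc₀, H₀⟩ := fineOp_inv_deriv_mulVec_decay_unif (d + 1) L (by omega) ⟨hLodd, hL1⟩ ha hm0
  refine ⟨c₀, δ₀, hc₀, hδ₀, ?_⟩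
  intro K hK N _ hN e M _ hM msq hmsq hcap μ lam F D hF x hD
  set P : Params := ⟨d + 1, L, e, K, by omega, ⟨hLodd, hL1⟩⟩ with hP
  have hMK : ∀ μ, M μ = P.sitesPerDir P.K := fun μ => by rw [hM μ]; simp [hP, Params.sitesPerDir]
  exact H₀ P rfl rfl hK msq hmsq.le hcap M hMK N hN lam F D hF x hD μ

/-- **(3.42), ENTRY `|G∇*λ|`, AT `U ≡ 1`**: `|(A₀⁻¹∇*_νλ)(x)| ≤ C·e^{−δD}·‖λ‖_∞`, `(∇*_νλ)(y) = N(λ(y − e_ν) − λ(y))` — Q3a `fullPropDTOp_decay_unif`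
(the transposed-gradient kernel) through Q4a `inv_mulVec_adjDeriv_eq_sum`; the real `D` is read at `⌈D⌉₊` (the block distance is an integer).
[cite: Balaban1985BackgroundPropagators, Thm 3.1 (3.42) p.397 (third entry); King1986, (2.13) p.653, Thm 3.3 (3.7) p.656; Balaban1983RegularityDecay, Theorem (1.10) p.573] -/
theorem fullPropAdjOp_sup_decay (hLodd : Odd L) (hL : 2 ≤ L) {a : ℝ} (ha : 0 < a) {m0sq : ℝ} (hm0 : 0 ≤ m0sq) :
    ∃ C δ : ℝ, 0 < C ∧ 0 < δ ∧ ∀ (K : ℕ), 1 ≤ K → ∀ (N : ℕ) [NeZero N], N = L ^ K →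
      ∀ (e : ℕ) (M : Fin (d + 1) → ℕ) [∀ μ, NeZero (M μ)], (∀ μ, M μ = 2 * L ^ e) →
      ∀ (msq : ℝ), 0 < msq → msq ≤ m0sq → ∀ (ν : Fin (d + 1)) (lam : Tor (fine N M) → ℝ) (F D : ℝ), (∀ y, |lam y| ≤ F) →
        ∀ x : Tor (fine N M), (∀ y, lam y ≠ 0 → D ≤ tdistT M (blockOf N M x) (blockOf N M y)) →
        |((fineOp N M (aK a L K) (((N : ℕ) : ℝ) ^ 2) msq)⁻¹ *ᵥ (fun y => (N : ℝ) * (lam (y - unitVec (fine N M) ν) - lam y))) x|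
          ≤ C * Real.exp (-(δ * D)) * F := by
  obtain ⟨C, δ, hC, hδ, H⟩ := fullPropDTOp_decay_unif (d := d) L hLodd hL ha hm0
  refine ⟨C, δ, hC, hδ, ?_⟩
  intro K hK N _ hN e M _ hM msq hmsq hcap ν lam F D hF x hD
  have hF0 : 0 ≤ F := (abs_nonneg _).trans (hF x)
  -- the integer reading of `D`
  have hDn : ∀ y, lam y ≠ 0 → ((⌈D⌉₊ : ℕ) : ℝ) ≤ tdistT M (blockOf N M x) (blockOf N M y) := by
    intro y hy
    obtain ⟨n, hn⟩ := exists_natCast_eq_tdistT M (blockOf N M x) (blockOf N M y)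
    have h := hD y hy
    rw [hn] at h ⊢
    exact_mod_cast Nat.ceil_le.mpr h
  have h := H K hK N hN e M hM msq hmsq hcap ν lam F hF ⌈D⌉₊ x hDn
  rw [inv_mulVec_adjDeriv_eq_sum]
  refine h.trans (mul_le_mul_of_nonneg_right (mul_le_mul_of_nonneg_left ?_ hC.le) hF0)
  exact Real.exp_le_exp.mpr (neg_le_neg (mul_le_mul_of_nonneg_left (Nat.le_ceil D) hδ.le))

omit [NeZero L] in
/-- **(3.42), ENTRY `|ΔGλ|`, AT `U ≡ 1`**: `|N²·Σ_μ[(A₀⁻¹λ)(x + e_μ) + (A₀⁻¹λ)(x − e_μ) − 2(A₀⁻¹λ)(x)]| ≤ C·e^{−δD}·‖λ‖_∞` — through the equation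
`Δ^ηA₀⁻¹λ = m²A₀⁻¹λ + a_KQ*QA₀⁻¹λ − λ` (Q4b `lap_inv_mulVec_eq`): the entry-0 bound at `x` and at every point of its block (`Q*Q` = block mean,
`blockMean_abs_le`), `a_K ≤ a`, and `|λ(x)| ≤ ‖λ‖_∞` (a point of the support has `D ≤ 0`).
[cite: Balaban1985BackgroundPropagators, Thm 3.1 (3.42) p.397 (fourth entry); King1986, (2.13) p.653, (4.1)–(4.5) p.670; Balaban1983RegularityDecay, (1.6) p.572, Theorem (1.10) p.573] -/
theorem fullPropLapOp_sup_decay (hLodd : Odd L) (hL : 2 ≤ L) {a : ℝ} (ha : 0 < a) {m0sq : ℝ} (hm0 : 0 ≤ m0sq) :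
    ∃ C δ : ℝ, 0 < C ∧ 0 < δ ∧ ∀ (K : ℕ), 1 ≤ K → ∀ (N : ℕ) [NeZero N], N = L ^ K →
      ∀ (e : ℕ) (M : Fin (d + 1) → ℕ) [∀ μ, NeZero (M μ)], (∀ μ, M μ = 2 * L ^ e) →
      ∀ (msq : ℝ), 0 < msq → msq ≤ m0sq → ∀ (lam : Tor (fine N M) → ℝ) (F D : ℝ), (∀ y, |lam y| ≤ F) →
        ∀ x : Tor (fine N M), (∀ y, lam y ≠ 0 → D ≤ tdistT M (blockOf N M x) (blockOf N M y)) →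
        |(((N : ℕ) : ℝ) ^ 2) * ∑ μ, (((fineOp N M (aK a L K) (((N : ℕ) : ℝ) ^ 2) msq)⁻¹ *ᵥ lam) (x + unitVec (fine N M) μ)
            + ((fineOp N M (aK a L K) (((N : ℕ) : ℝ) ^ 2) msq)⁻¹ *ᵥ lam) (x - unitVec (fine N M) μ)
            - 2 * ((fineOp N M (aK a L K) (((N : ℕ) : ℝ) ^ 2) msq)⁻¹ *ᵥ lam) x)|
          ≤ C * Real.exp (-(δ * D)) * F := by
  have hL1 : 1 < L := by omega
  have hL1r : (1 : ℝ) < L := by exact_mod_cast hL1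
  obtain ⟨c₀, δ₀, hc₀, hδ₀, H₀⟩ := fullPropOp_sup_decay (d := d) L hLodd hL ha hm0
  refine ⟨m0sq * c₀ + a * c₀ + 1, δ₀, by positivity, hδ₀, ?_⟩
  intro K hK N _ hN e M _ hM msq hmsq hcap lam F D hF x hD
  have hF0 : 0 ≤ F := (abs_nonneg _).trans (hF x)
  have haK : 0 ≤ aK a L K := (aK_pos ha hL1r hK).le
  have haKle : aK a L K ≤ a := aK_le ha hL1r hK
  set g : Tor (fine N M) → ℝ := (fineOp N M (aK a L K) (((N : ℕ) : ℝ) ^ 2) msq)⁻¹ *ᵥ lam with hg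
  set E : ℝ := Real.exp (-(δ₀ * D)) with hE
  rw [lap_inv_mulVec_eq N M haK (sq_nonneg _) hmsq lam x]
  -- entry 0 at every point of the block of `x` (same distance `D` to the support)
  have hpt : ∀ y, blockOf N M x = blockOf N M y → |g y| ≤ c₀ * E * F := by
    intro y hb
    have hDy : ∀ z, lam z ≠ 0 → D ≤ tdistT M (blockOf N M y) (blockOf N M z) := fun z hz => by rw [← hb]; exact hD z hz
    exact H₀ K hK N hN e M hM msq hmsq hcap lam F D hF y hDy
  have h0 : |g x| ≤ c₀ * E * F := hpt x rfl
  have hP : |(blockProj N M *ᵥ g) x| ≤ c₀ * E * F := by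
    rw [blockProj_mulVec_apply]; exact blockMean_abs_le N M g x hpt
  -- the source at `x`: zero, or `x` lies in the support and `D ≤ 0`
  have hlam : |lam x| ≤ E * F := by
    by_cases hx : lam x = 0
    · rw [hx, abs_zero]; positivity
    · have hD0 : D ≤ 0 := by have h := hD x hx; rwa [tdistT_self] at h
      have hE1 : 1 ≤ E := by rw [hE, ← Real.exp_zero]; exact Real.exp_le_exp.mpr (by nlinarith)
      calc |lam x| ≤ F := hF x
        _ = 1 * F := (one_mul F).symm
        _ ≤ E * F := mul_le_mul_of_nonneg_right hE1 hF0
  have htri : |msq * g x + aK a L K * (blockProj N M *ᵥ g) x - lam x|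
      ≤ |msq * g x| + |aK a L K * (blockProj N M *ᵥ g) x| + |lam x| := by
    rw [sub_eq_add_neg]
    exact (abs_add_three _ _ _).trans (by rw [abs_neg])
  calc |msq * g x + aK a L K * (blockProj N M *ᵥ g) x - lam x|
      ≤ |msq * g x| + |aK a L K * (blockProj N M *ᵥ g) x| + |lam x| := htri
    _ ≤ msq * (c₀ * E * F) + aK a L K * (c₀ * E * F) + E * F := by
        rw [abs_mul, abs_mul, abs_of_nonneg hmsq.le, abs_of_nonneg haK]
        exact add_le_add (add_le_add (mul_le_mul_of_nonneg_left h0 hmsq.le) (mul_le_mul_of_nonneg_left hP haK)) hlam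
    _ ≤ m0sq * (c₀ * E * F) + a * (c₀ * E * F) + E * F := by
        have hq : 0 ≤ c₀ * E * F := by positivity
        nlinarith [mul_le_mul_of_nonneg_right hcap hq, mul_le_mul_of_nonneg_right haKle hq]
    _ = (m0sq * c₀ + a * c₀ + 1) * E * F := by ring

/-! ## §2 Theorem 3.1 at `U ≡ 1`: the eight sup ∕ Hölder displays under one `(C, δ)` -/

/-- ★★★ **[B9] THEOREM 3.1 AT `U ≡ 1` FOR KING'S FULL `A = 0` FLUCTUATION PROPAGATOR — ALL SUP ∕ HÖLDER DISPLAYS, ONE `(C, δ)`.**  For `d ≥ 1`, odd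
`L ≥ 3`, `a > 0`, `m₀² ≥ 0`, `0 < α < 1` and `0 < ε ≤ 1` there are `C, δ > 0` such that for every `K ≥ 1` (`N = L^K`), cube `M_μ = 2L^e`, mass
`0 < m² ≤ m₀²`, with `A₀ = fineOp N M a_K N² m²` (`(A₀⁻¹f)(x) = η^{d+1}Σ_yG(x, y)f(y)`), `(∇*_νg)(y) = N(g(y − e_ν) − g(y))`, and `D ≥ 0` any lower bound of
the block distance from the observation block(s) to `supp λ`:
(3.42)₀ `|(A₀⁻¹λ)(x)| ≤ Ce^{−δD}‖λ‖_∞`; (3.42)₁ `|N((A₀⁻¹λ)(x+e_μ) − (A₀⁻¹λ)(x))| ≤ Ce^{−δD}‖λ‖_∞`; (3.42)₂ `|(A₀⁻¹∇*_νλ)(x)| ≤ Ce^{−δD}‖λ‖_∞`;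
(3.42)₃ `|N²Σ_μ[(A₀⁻¹λ)(x+e_μ) + (A₀⁻¹λ)(x−e_μ) − 2(A₀⁻¹λ)(x)]| ≤ Ce^{−δD}‖λ‖_∞`;
(3.43)₁ `(|x−x′|∕N)^{−α}|N((A₀⁻¹λ)(x′+e_μ) − (A₀⁻¹λ)(x′)) − N((A₀⁻¹λ)(x+e_μ) − (A₀⁻¹λ)(x))| ≤ Ce^{−δD}‖λ‖_∞`;
(3.43)₂ `(|x−x′|∕N)^{−α}|(A₀⁻¹∇*_νλ)(x′) − (A₀⁻¹∇*_νλ)(x)| ≤ Ce^{−δD}‖λ‖_∞`;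
(3.44) `|N((A₀⁻¹∇*_μλ)(x+e_μ′) − (A₀⁻¹∇*_μλ)(x))| ≤ C·H·e^{−δD}` (`H` = ε-Hölder modulus of `λ`);
(3.45) `(|x−x′|∕N)^{−α}|N((A₀⁻¹∇*_μλ)(x′+e_μ′) − (A₀⁻¹∇*_μλ)(x′)) − N((A₀⁻¹∇*_μλ)(x+e_μ′) − (A₀⁻¹∇*_μλ)(x))| ≤ C·H·e^{−δD}` (`H` = α-Hölder modulus; sharp).
At unit-scale sites (`L^kη = 1`) the printed prefactors `[(L^jη)², L^jη, L^jη, 1]`, `(L^jη)^{1−β}`, `(L^jη)^{−β}` are all `1`.  The `L²` block (3.46)–(3.47) is part X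
`fullPropOps_l2_unif`.  Decided in the MODEL; not the printed proposition; not a discharge.
[cite: Balaban1985BackgroundPropagators, Thm 3.1 (3.42)–(3.45) pp.397–398; Balaban1983RegularityDecay, Theorem (1.9)–(1.10) p.573; King1986, (2.13) p.653, Thm 3.3 (3.7)–(3.8) p.656, Prop. 3.7 (3.63)/(3.65) p.663] -/
theorem kingFullProp_B9Thm31_at_trivialU (hd : 1 ≤ d) (hLodd : Odd L) (hL : 2 ≤ L) {a : ℝ} (ha : 0 < a) {m0sq : ℝ}
    (hm0 : 0 ≤ m0sq) {α : ℝ} (hα0 : 0 < α) (hα1 : α < 1) {ε : ℝ} (hε0 : 0 < ε) (hε1 : ε ≤ 1) :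
    ∃ C δ : ℝ, 0 < C ∧ 0 < δ ∧ ∀ (K : ℕ), 1 ≤ K → ∀ (N : ℕ) [NeZero N], N = L ^ K →
      ∀ (e : ℕ) (M : Fin (d + 1) → ℕ) [∀ μ, NeZero (M μ)], (∀ μ, M μ = 2 * L ^ e) →
      ∀ (msq : ℝ), 0 < msq → msq ≤ m0sq →
        -- (3.42)₀
        (∀ (lam : Tor (fine N M) → ℝ) (F D : ℝ), 0 ≤ D → (∀ y, |lam y| ≤ F) → ∀ x : Tor (fine N M),
          (∀ y, lam y ≠ 0 → D ≤ tdistT M (blockOf N M x) (blockOf N M y)) →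
          |((fineOp N M (aK a L K) (((N : ℕ) : ℝ) ^ 2) msq)⁻¹ *ᵥ lam) x| ≤ C * Real.exp (-(δ * D)) * F) ∧
        -- (3.42)₁
        (∀ (μ : Fin (d + 1)) (lam : Tor (fine N M) → ℝ) (F D : ℝ), 0 ≤ D → (∀ y, |lam y| ≤ F) → ∀ x : Tor (fine N M),
          (∀ y, lam y ≠ 0 → D ≤ tdistT M (blockOf N M x) (blockOf N M y)) →
          |(N : ℝ) * (((fineOp N M (aK a L K) (((N : ℕ) : ℝ) ^ 2) msq)⁻¹ *ᵥ lam) (x + unitVec (fine N M) μ)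
              - ((fineOp N M (aK a L K) (((N : ℕ) : ℝ) ^ 2) msq)⁻¹ *ᵥ lam) x)| ≤ C * Real.exp (-(δ * D)) * F) ∧
        -- (3.42)₂
        (∀ (ν : Fin (d + 1)) (lam : Tor (fine N M) → ℝ) (F D : ℝ), 0 ≤ D → (∀ y, |lam y| ≤ F) → ∀ x : Tor (fine N M),
          (∀ y, lam y ≠ 0 → D ≤ tdistT M (blockOf N M x) (blockOf N M y)) →
          |((fineOp N M (aK a L K) (((N : ℕ) : ℝ) ^ 2) msq)⁻¹ *ᵥ (fun y => (N : ℝ) * (lam (y - unitVec (fine N M) ν) - lam y))) x|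
            ≤ C * Real.exp (-(δ * D)) * F) ∧
        -- (3.42)₃
        (∀ (lam : Tor (fine N M) → ℝ) (F D : ℝ), 0 ≤ D → (∀ y, |lam y| ≤ F) → ∀ x : Tor (fine N M),
          (∀ y, lam y ≠ 0 → D ≤ tdistT M (blockOf N M x) (blockOf N M y)) →
          |(((N : ℕ) : ℝ) ^ 2) * ∑ μ, (((fineOp N M (aK a L K) (((N : ℕ) : ℝ) ^ 2) msq)⁻¹ *ᵥ lam) (x + unitVec (fine N M) μ)
              + ((fineOp N M (aK a L K) (((N : ℕ) : ℝ) ^ 2) msq)⁻¹ *ᵥ lam) (x - unitVec (fine N M) μ)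
              - 2 * ((fineOp N M (aK a L K) (((N : ℕ) : ℝ) ^ 2) msq)⁻¹ *ᵥ lam) x)|
            ≤ C * Real.exp (-(δ * D)) * F) ∧
        -- (3.43)₁
        (∀ (μ : Fin (d + 1)) (lam : Tor (fine N M) → ℝ) (F D : ℝ), 0 ≤ D → (∀ y, |lam y| ≤ F) → ∀ x x' : Tor (fine N M),
          (∀ y, lam y ≠ 0 → D ≤ tdistT M (blockOf N M x) (blockOf N M y)) →
          (∀ y, lam y ≠ 0 → D ≤ tdistT M (blockOf N M x') (blockOf N M y)) →
          (tdistT (fine N M) x x' / (N : ℝ)) ^ (-α) *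
            |(N : ℝ) * (((fineOp N M (aK a L K) (((N : ℕ) : ℝ) ^ 2) msq)⁻¹ *ᵥ lam) (x' + unitVec (fine N M) μ)
                - ((fineOp N M (aK a L K) (((N : ℕ) : ℝ) ^ 2) msq)⁻¹ *ᵥ lam) x')
              - (N : ℝ) * (((fineOp N M (aK a L K) (((N : ℕ) : ℝ) ^ 2) msq)⁻¹ *ᵥ lam) (x + unitVec (fine N M) μ)
                - ((fineOp N M (aK a L K) (((N : ℕ) : ℝ) ^ 2) msq)⁻¹ *ᵥ lam) x)|
            ≤ C * Real.exp (-(δ * D)) * F) ∧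
        -- (3.43)₂
        (∀ (ν : Fin (d + 1)) (lam : Tor (fine N M) → ℝ) (F D : ℝ), 0 ≤ D → (∀ y, |lam y| ≤ F) → ∀ x x' : Tor (fine N M),
          (∀ y, lam y ≠ 0 → D ≤ tdistT M (blockOf N M x) (blockOf N M y)) →
          (∀ y, lam y ≠ 0 → D ≤ tdistT M (blockOf N M x') (blockOf N M y)) →
          (tdistT (fine N M) x x' / (N : ℝ)) ^ (-α) *
            |((fineOp N M (aK a L K) (((N : ℕ) : ℝ) ^ 2) msq)⁻¹ *ᵥ (fun y => (N : ℝ) * (lam (y - unitVec (fine N M) ν) - lam y))) x'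
              - ((fineOp N M (aK a L K) (((N : ℕ) : ℝ) ^ 2) msq)⁻¹ *ᵥ (fun y => (N : ℝ) * (lam (y - unitVec (fine N M) ν) - lam y))) x|
            ≤ C * Real.exp (-(δ * D)) * F) ∧
        -- (3.44)
        (∀ (μ μ' : Fin (d + 1)) (lam : Tor (fine N M) → ℝ) (H D : ℝ), 0 ≤ H → 0 ≤ D →
          (∀ y y', |lam y - lam y'| ≤ H * (tdistT (fine N M) y y' / (N : ℝ)) ^ ε) → ∀ x : Tor (fine N M),
          (∀ y, lam y ≠ 0 → D ≤ tdistT M (blockOf N M x) (blockOf N M y)) →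
          |(N : ℝ) * (((fineOp N M (aK a L K) (((N : ℕ) : ℝ) ^ 2) msq)⁻¹
                  *ᵥ (fun y => (N : ℝ) * (lam (y - unitVec (fine N M) μ) - lam y))) (x + unitVec (fine N M) μ')
              - ((fineOp N M (aK a L K) (((N : ℕ) : ℝ) ^ 2) msq)⁻¹
                  *ᵥ (fun y => (N : ℝ) * (lam (y - unitVec (fine N M) μ) - lam y))) x)|
            ≤ C * H * Real.exp (-(δ * D))) ∧
        -- (3.45)
        (∀ (μ μ' : Fin (d + 1)) (lam : Tor (fine N M) → ℝ) (H D : ℝ), 0 ≤ H → 0 ≤ D →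
          (∀ y y', |lam y - lam y'| ≤ H * (tdistT (fine N M) y y' / (N : ℝ)) ^ α) → ∀ x x' : Tor (fine N M),
          (∀ y, lam y ≠ 0 → D ≤ tdistT M (blockOf N M x) (blockOf N M y)) →
          (∀ y, lam y ≠ 0 → D ≤ tdistT M (blockOf N M x') (blockOf N M y)) →
          (tdistT (fine N M) x x' / (N : ℝ)) ^ (-α) *
            |((N : ℝ) * (((fineOp N M (aK a L K) (((N : ℕ) : ℝ) ^ 2) msq)⁻¹
                  *ᵥ (fun y => (N : ℝ) * (lam (y - unitVec (fine N M) μ) - lam y))) (x' + unitVec (fine N M) μ')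
                - ((fineOp N M (aK a L K) (((N : ℕ) : ℝ) ^ 2) msq)⁻¹
                  *ᵥ (fun y => (N : ℝ) * (lam (y - unitVec (fine N M) μ) - lam y))) x'))
             - ((N : ℝ) * (((fineOp N M (aK a L K) (((N : ℕ) : ℝ) ^ 2) msq)⁻¹
                  *ᵥ (fun y => (N : ℝ) * (lam (y - unitVec (fine N M) μ) - lam y))) (x + unitVec (fine N M) μ')
                - ((fineOp N M (aK a L K) (((N : ℕ) : ℝ) ^ 2) msq)⁻¹
                  *ᵥ (fun y => (N : ℝ) * (lam (y - unitVec (fine N M) μ) - lam y))) x))|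
            ≤ C * H * Real.exp (-(δ * D))) := by
  obtain ⟨C₀, δ₀, hC₀, hδ₀, H₀⟩ := fullPropOp_sup_decay (d := d) L hLodd hL ha hm0
  obtain ⟨C₁, δ₁, hC₁, hδ₁, H₁⟩ := fullPropDOp_sup_decay (d := d) L hLodd hL ha hm0
  obtain ⟨C₂, δ₂, hC₂, hδ₂, H₂⟩ := fullPropAdjOp_sup_decay (d := d) L hLodd hL ha hm0
  obtain ⟨C₃, δ₃, hC₃, hδ₃, H₃⟩ := fullPropLapOp_sup_decay (d := d) L hLodd hL ha hm0
  obtain ⟨C₄, δ₄, hC₄, hδ₄, H₄⟩ := kingFullProp_B9Thm31_holder_at_trivialU (d := d) L hd hLodd hL ha hm0 hα0 hα1 hε0 hε1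
  set C : ℝ := max (max (max C₀ C₁) (max C₂ C₃)) C₄ with hCdef
  set δ : ℝ := min (min (min δ₀ δ₁) (min δ₂ δ₃)) δ₄ with hδdef
  have hc0 : C₀ ≤ C := ((le_max_left _ _).trans (le_max_left _ _)).trans (le_max_left _ _)
  have hc1 : C₁ ≤ C := ((le_max_right _ _).trans (le_max_left _ _)).trans (le_max_left _ _)
  have hc2 : C₂ ≤ C := ((le_max_left _ _).trans (le_max_right _ _)).trans (le_max_left _ _)
  have hc3 : C₃ ≤ C := ((le_max_right _ _).trans (le_max_right _ _)).trans (le_max_left _ _)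
  have hc4 : C₄ ≤ C := le_max_right _ _
  have hd0 : δ ≤ δ₀ := ((min_le_left _ _).trans (min_le_left _ _)).trans (min_le_left _ _)
  have hd1 : δ ≤ δ₁ := ((min_le_left _ _).trans (min_le_left _ _)).trans (min_le_right _ _)
  have hd2 : δ ≤ δ₂ := ((min_le_left _ _).trans (min_le_right _ _)).trans (min_le_left _ _)
  have hd3 : δ ≤ δ₃ := ((min_le_left _ _).trans (min_le_right _ _)).trans (min_le_right _ _)
  have hd4 : δ ≤ δ₄ := min_le_right _ _
  have hδ : 0 < δ := lt_min (lt_min (lt_min hδ₀ hδ₁) (lt_min hδ₂ hδ₃)) hδ₄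
  have hC0 : 0 ≤ C := hC₀.le.trans hc0
  -- monotonicity of the two bound shapes in `(C, δ)` for `D ≥ 0`
  have hexp : ∀ {δi D : ℝ}, δ ≤ δi → 0 ≤ D → Real.exp (-(δi * D)) ≤ Real.exp (-(δ * D)) :=
    fun hδi hD => Real.exp_le_exp.mpr (neg_le_neg (mul_le_mul_of_nonneg_right hδi hD))
  have hmono : ∀ {Ci δi D X : ℝ}, Ci ≤ C → δ ≤ δi → 0 ≤ D → 0 ≤ X →
      Ci * Real.exp (-(δi * D)) * X ≤ C * Real.exp (-(δ * D)) * X :=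
    fun hCi hδi hD hX => mul_le_mul (mul_le_mul hCi (hexp hδi hD) (Real.exp_pos _).le hC0) le_rfl hX (by positivity)
  have hmono' : ∀ {Ci δi D X : ℝ}, Ci ≤ C → δ ≤ δi → 0 ≤ D → 0 ≤ X →
      Ci * X * Real.exp (-(δi * D)) ≤ C * X * Real.exp (-(δ * D)) := by
    intro Ci δi D X hCi hδi hD hX
    have := hmono hCi hδi hD hX
    linarith
  refine ⟨C, δ, lt_of_lt_of_le hC₀ hc0, hδ, ?_⟩
  intro K hK N _ hN e M _ hM msq hmsq hcap
  obtain ⟨g1, g2, g3, g4⟩ := H₄ K hK N hN e M hM msq hmsq hcap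
  refine ⟨?_, ?_, ?_, ?_, ?_, ?_, ?_, ?_⟩
  · intro lam F D hD hF x hDx
    have hF0 : 0 ≤ F := (abs_nonneg _).trans (hF x)
    exact (H₀ K hK N hN e M hM msq hmsq hcap lam F D hF x hDx).trans (hmono hc0 hd0 hD hF0)
  · intro μ lam F D hD hF x hDx
    have hF0 : 0 ≤ F := (abs_nonneg _).trans (hF x)
    exact (H₁ K hK N hN e M hM msq hmsq hcap μ lam F D hF x hDx).trans (hmono hc1 hd1 hD hF0)
  · intro ν lam F D hD hF x hDx
    have hF0 : 0 ≤ F := (abs_nonneg _).trans (hF x)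
    exact (H₂ K hK N hN e M hM msq hmsq hcap ν lam F D hF x hDx).trans (hmono hc2 hd2 hD hF0)
  · intro lam F D hD hF x hDx
    have hF0 : 0 ≤ F := (abs_nonneg _).trans (hF x)
    exact (H₃ K hK N hN e M hM msq hmsq hcap lam F D hF x hDx).trans (hmono hc3 hd3 hD hF0)
  · intro μ lam F D hD hF x x' hDx hDx'
    have hF0 : 0 ≤ F := (abs_nonneg _).trans (hF x)
    exact (g1 μ lam F D hD hF x x' hDx hDx').trans (hmono hc4 hd4 hD hF0)
  · intro ν lam F D hD hF x x' hDx hDx'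
    have hF0 : 0 ≤ F := (abs_nonneg _).trans (hF x)
    exact (g2 ν lam F D hD hF x x' hDx hDx').trans (hmono hc4 hd4 hD hF0)
  · intro μ μ' lam Hh D hH0 hD hH x hDx
    exact (g3 μ μ' lam Hh D hH0 hD hH x hDx).trans (hmono' hc4 hd4 hD hH0)
  · intro μ μ' lam Hh D hH0 hD hH x x' hDx hDx'
    exact (g4 μ μ' lam Hh D hH0 hD hH x x' hDx hDx').trans (hmono' hc4 hd4 hD hH0)

end Summit.QuantumFields.YangMills.BalabanUVNodes.N15KingModelRung.Curved
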